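import Summits.ValiantsHypothesis.ValiantsHypothesis.Theorems.LacunarySymmetroidMatrixDescartesFiniteSectorSectorCeilingMTwo

/-!
# `MatrixDescartes` — line «finite»: the `m = 2` SECTOR CEILING, rows `K = 3, 4, 5` (kernel): `η(2,3) ≤ 8`, `η(2,4) ≤ 16`, `η(2,5) ≤ 24`

Companion of `…FiniteSectorSectorCeilingMTwo` (`HypRootLawAt 2 6 32`; `memP_prefix` and the method live there):
the same SIEVE-to-kernel transfer for `K = 3, 4, 5` with `σ(2,K) = 8, 16, 24` (maximal pair-sum chains ONLY at `{0,2,4}` / `{0,2,6}`, `2·{0,1,3,4}`,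
`2·{0,1,3,5,6}` — located by exact DFS).  With `eta_two_row_lower` (…FiniteSectorEtaTwoSix) the rows read `η(2,3) = 8`, `η(2,4) = 16`, `η(2,5) = 24`
EXACT BOTH SIDES BY NAME.  HONEST FRAMING as in the main file: helper of stmt-ValiantsHypothesis-18050 with no closure claim; nothing on the crux
(asymptotic), the doors, or `VP ≠ VNP`.  Seat val-sym-door-p5 g7 (desk R2488 (A)).
[folklore] Gap-rule / sieve bookkeeping plus a finite enumeration; no citation is load-bearing.
-/

-- `Summit.ValiantsHypothesis.ValiantsHypothesis.…` repeats a component by the D-0017 layout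
-- (single-conjunct summit), which the `dupNamespace` linter flags; the name is mandated.
set_option linter.dupNamespace false

namespace Summit.ValiantsHypothesis.ValiantsHypothesis.Theorems.LacunarySymmetroidMatrixDescartes.FiniteSector

open scoped BigOperators Matrix
open Polynomial

/-! ## `K = 3`: `σ(2,3) = 8` -/

set_option synthInstance.maxSize 2000000 in
set_option synthInstance.maxHeartbeats 2000000 in
set_option maxHeartbeats 4000000 in
/-- **Finite core of `σ(2,3) = 8`** (pruned nested enumeration, `decide` in the kernel): for every strictly increasing
`0 < a < b < 12` whose sorted prefixes keep the step-≤-2 pair-sum chain alive (the only candidates), if the chain of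
`{0,a,b}` reaches `7` then `9` is NOT a pair sum and `8`, `10` are not BOTH pair sums. [folklore] -/
theorem sectorCheck_two_three :
    ∀ a ∈ List.range 12, (0 < a ∧ (∀ r ∈ List.range (min 8 (a - 1)), (∃ x ∈ [0], ∃ y ∈ [0], x + y = r) ∨ (∃ x ∈ [0], ∃ y ∈ [0], x + y = r + 1))) →
    ∀ b ∈ List.range 12, (a < b ∧ (∀ r ∈ List.range (min 8 (b - 1)), (∃ x ∈ [0, a], ∃ y ∈ [0, a], x + y = r) ∨ (∃ x ∈ [0, a], ∃ y ∈ [0, a], x + y = r + 1))) →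
    ((∀ r ∈ List.range 8, (∃ x ∈ [0, a, b], ∃ y ∈ [0, a, b], x + y = r) ∨ (∃ x ∈ [0, a, b], ∃ y ∈ [0, a, b], x + y = r + 1)) → (¬ (∃ x ∈ [0, a, b], ∃ y ∈ [0, a, b], x + y = 9) ∧ ¬ ((∃ x ∈ [0, a, b], ∃ y ∈ [0, a, b], x + y = 8) ∧ (∃ x ∈ [0, a, b], ∃ y ∈ [0, a, b], x + y = 10)))) := by
  decide +kernel

/-- **`η(2,3) ≤ 8 = σ(2,3)`**: every in-sector (`#distinct real roots = natDegree`) determinant of a real symmetric `2 × 2` lacunary pencil with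
`3` terms has degree `≤ 8` — `HypRootLawAt 2 3 8`.  (SIEVE `FiniteSector.sieve` + `natDegree_mem_sumset` ⇒ pair-sum chain; values capped at
`11`, value set padded to `3` distinct values and sorted; `sectorCheck_two_three`.) [folklore] -/
theorem hypRootLawAt_two_three_8 : HypRootLawAt 2 3 8 := by
  intro d S hS hsec
  by_contra hdeg'
  have hdeg : 8 < (pencil d S).det.natDegree := not_le.mp hdeg'
  have hq : (pencil d S).det ≠ 0 := by
    intro h0
    rw [h0] at hdeg
    simp at hdeg
  -- pair sums of exponents
  have hpair : ∀ r, r ∈ (Finset.univ : Finset (Sym (Fin 3) 2)).image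
      (fun s : Sym (Fin 3) 2 => ((s : Multiset (Fin 3)).map d).sum) → ∃ i j : Fin 3, d i + d j = r := by
    intro r hr
    rw [Finset.mem_image] at hr
    obtain ⟨s, -, hs⟩ := hr
    have hcard2 : Multiset.card (s : Multiset (Fin 3)) = 2 := s.2
    obtain ⟨i, j, hij⟩ := Multiset.card_eq_two.mp hcard2
    refine ⟨i, j, ?_⟩
    have hsum : ((s : Multiset (Fin 3)).map d).sum = d i + d j := by
      rw [hij]
      simp
    omega
  have hchain : ∀ r, r + 2 ≤ (pencil d S).det.natDegree →
      (∃ i j : Fin 3, d i + d j = r) ∨ (∃ i j : Fin 3, d i + d j = r + 1) := by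
    intro r hr
    rcases sieve d S hq hsec hr with h | h
    · exact Or.inl (hpair _ h)
    · exact Or.inr (hpair _ h)
  have htop : ∃ i j : Fin 3, d i + d j = (pencil d S).det.natDegree := hpair _ (natDegree_mem_sumset d S hq)
  -- capped values, the value set, padding, sorting
  set cv : Fin 3 → ℕ := fun i => min (d i) 11 with hcv
  have hcvd : ∀ i, d i ≤ 10 → cv i = d i := fun i hi => by
    simp only [hcv]
    exact Nat.min_eq_left (by omega)
  have hcvle : ∀ i, cv i ≤ 11 := fun i => Nat.min_le_right _ _
  set V : Finset ℕ := Finset.univ.image cv with hV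
  have hcvV : ∀ i, cv i ∈ V := fun i => Finset.mem_image_of_mem cv (Finset.mem_univ i)
  have h0V : 0 ∈ V := by
    rcases hchain 0 (by omega) with ⟨i, j, hij⟩ | ⟨i, j, hij⟩
    · have : cv i = 0 := by rw [hcvd i (by omega)]; omega
      exact this ▸ hcvV i
    · rcases Nat.eq_zero_or_pos (d i) with hi | hi
      · have : cv i = 0 := by rw [hcvd i (by omega)]; omega
        exact this ▸ hcvV i
      · have : cv j = 0 := by rw [hcvd j (by omega)]; omega
        exact this ▸ hcvV j
  set W : Finset ℕ := V.erase 0 with hW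
  have hWsub : W ⊆ (Finset.range 12).erase 0 := by
    intro u hu
    rw [hW, Finset.mem_erase] at hu
    obtain ⟨hu0, huV⟩ := hu
    rw [hV, Finset.mem_image] at huV
    obtain ⟨i, -, rfl⟩ := huV
    rw [Finset.mem_erase, Finset.mem_range]
    exact ⟨hu0, Nat.lt_succ_of_le (hcvle i)⟩
  have hWcard : W.card ≤ 2 := by
    have hVK : V.card ≤ 3 := by
      have := Finset.card_image_le (s := (Finset.univ : Finset (Fin 3))) (f := cv)
      simpa using this
    have h1 : W.card + 1 = V.card := by rw [hW]; exact Finset.card_erase_add_one h0V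
    omega
  obtain ⟨W', hWW', hW'sub, hW'card⟩ := Finset.exists_subsuperset_card_eq hWsub hWcard
    (by rw [Finset.card_erase_of_mem (by simp), Finset.card_range]; omega)
  have hVW' : ∀ u ∈ V, u = 0 ∨ u ∈ W' := by
    intro u hu
    by_cases hu0 : u = 0
    · exact Or.inl hu0
    · exact Or.inr (hWW' (by rw [hW, Finset.mem_erase]; exact ⟨hu0, hu⟩))
  have hlmem : ∀ u, u ∈ Finset.sort W' ↔ u ∈ W' := fun u => Finset.mem_sort _
  have hlsort : (Finset.sort W').SortedLT := Finset.sortedLT_sort W'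
  have hllen : (Finset.sort W').length = 2 := by rw [Finset.length_sort, hW'card]
  generalize hl : Finset.sort W' = l at hlmem hlsort hllen
  -- name the sorted values
  rcases l with _ | ⟨a, _ | ⟨b, _ | ⟨zz, ll⟩⟩⟩
  all_goals simp only [List.length_cons, List.length_nil] at hllen
  all_goals try omega
  -- bounds and order
  have hmemR : ∀ u, u ∈ [a, b] → u ∈ List.range 12 := by
    intro u hu
    have hu' : u ∈ W' := (hlmem u).mp hu
    have := hW'sub hu'
    rw [Finset.mem_erase, Finset.mem_range] at this
    exact List.mem_range.mpr this.2
  have hne0 : ∀ u, u ∈ [a, b] → u ≠ 0 := by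
    intro u hu
    have hu' : u ∈ W' := (hlmem u).mp hu
    have := hW'sub hu'
    rw [Finset.mem_erase] at this
    exact this.1
  have h0 : 0 < a := Nat.pos_of_ne_zero (hne0 a (by simp))
  -- membership transfer: a pair sum `r ≤ 10` of `d` is a pair sum of the sorted value list
  have hmemP : ∀ r, r ≤ 10 → (∃ i j : Fin 3, d i + d j = r) → (∃ x ∈ [0, a, b], ∃ y ∈ [0, a, b], x + y = r) := by
    rintro r hr ⟨i, j, hij⟩
    have hi : cv i = d i := hcvd i (by omega)
    have hj : cv j = d j := hcvd j (by omega)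
    have hin : ∀ u ∈ V, u ∈ [0, a, b] := by
      intro u hu
      rcases hVW' u hu with h | h
      · rw [h]; simp
      · exact List.mem_cons_of_mem _ ((hlmem u).mpr h)
    exact ⟨cv i, hin _ (hcvV i), cv j, hin _ (hcvV j), by rw [hi, hj]; exact hij⟩
  have hchainP : ∀ r, r ≤ 7 → (∃ x ∈ [0, a, b], ∃ y ∈ [0, a, b], x + y = r) ∨ (∃ x ∈ [0, a, b], ∃ y ∈ [0, a, b], x + y = r + 1) := by
    intro r hr
    rcases hchain r (by omega) with h | h
    · exact Or.inl (hmemP r (by omega) h)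
    · exact Or.inr (hmemP (r + 1) (by omega) h)
  have hfull : (∀ r ∈ List.range 8, (∃ x ∈ [0, a, b], ∃ y ∈ [0, a, b], x + y = r) ∨ (∃ x ∈ [0, a, b], ∃ y ∈ [0, a, b], x + y = r + 1)) := fun r hr => hchainP r (by have := List.mem_range.mp hr; omega)
  have hlt1 : a < b := by
    have := hlsort (show (⟨0, by simp⟩ : Fin [a, b].length) < ⟨1, by simp⟩ from Fin.mk_lt_mk.mpr (by norm_num))
    simpa using this
  have pre1 : (∀ r ∈ List.range (min 8 (a - 1)), (∃ x ∈ [0], ∃ y ∈ [0], x + y = r) ∨ (∃ x ∈ [0], ∃ y ∈ [0], x + y = r + 1)) := by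
    intro r hr
    rw [List.mem_range] at hr
    have hrT : r < 8 := lt_of_lt_of_le hr (min_le_left _ _)
    have hrv : r < a - 1 := lt_of_lt_of_le hr (min_le_right _ _)
    have hr' : r + 1 < a := by omega
    have hrest : ∀ y ∈ [a, b], a ≤ y := by
      intro y hy
      simp only [List.mem_cons, List.mem_nil_iff, or_false] at hy
      omega
    rcases hchainP r (by omega) with h | h
    · exact Or.inl (memP_prefix (l₁ := [0]) (l₂ := [a, b]) hrest (by omega) h)
    · exact Or.inr (memP_prefix (l₁ := [0]) (l₂ := [a, b]) hrest hr' h)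
  have pre2 : (∀ r ∈ List.range (min 8 (b - 1)), (∃ x ∈ [0, a], ∃ y ∈ [0, a], x + y = r) ∨ (∃ x ∈ [0, a], ∃ y ∈ [0, a], x + y = r + 1)) := by
    intro r hr
    rw [List.mem_range] at hr
    have hrT : r < 8 := lt_of_lt_of_le hr (min_le_left _ _)
    have hrv : r < b - 1 := lt_of_lt_of_le hr (min_le_right _ _)
    have hr' : r + 1 < b := by omega
    have hrest : ∀ y ∈ [b], b ≤ y := by
      intro y hy
      simp only [List.mem_cons, List.mem_nil_iff, or_false] at hy
      omega
    rcases hchainP r (by omega) with h | h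
    · exact Or.inl (memP_prefix (l₁ := [0, a]) (l₂ := [b]) hrest (by omega) h)
    · exact Or.inr (memP_prefix (l₁ := [0, a]) (l₂ := [b]) hrest hr' h)
  -- apply the kernel check
  obtain ⟨hno9, hno810⟩ := sectorCheck_two_three a (hmemR a (by simp)) ⟨h0, pre1⟩ b (hmemR b (by simp)) ⟨hlt1, pre2⟩ hfull
  -- degree 9, 10, or ≥ 11: each contradicts the check
  rcases Nat.lt_or_ge (pencil d S).det.natDegree 11 with hsmall | hbig
  · interval_cases h : (pencil d S).det.natDegree
    · exact hno9 (hmemP 9 (by omega) (h ▸ htop))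
    · have h10 : (∃ x ∈ [0, a, b], ∃ y ∈ [0, a, b], x + y = 10) :=
        hmemP 10 (by omega) (h ▸ htop)
      rcases hchain 8 (by omega) with h' | h'
      · exact hno810 ⟨hmemP 8 (by omega) h', h10⟩
      · exact hno9 (hmemP 9 (by omega) h')
  · rcases hchain 8 (by omega) with h1 | h1
    · rcases hchain 9 (by omega) with h2 | h2
      · exact hno9 (hmemP 9 (by omega) h2)
      · exact hno810 ⟨hmemP 8 (by omega) h1, hmemP 10 (by omega) h2⟩
    · exact hno9 (hmemP 9 (by omega) h1)

/-! ## `K = 4`: `σ(2,4) = 16` -/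

set_option synthInstance.maxSize 2000000 in
set_option synthInstance.maxHeartbeats 2000000 in
set_option maxHeartbeats 4000000 in
/-- **Finite core of `σ(2,4) = 16`** (pruned nested enumeration, `decide` in the kernel): for every strictly increasing
`0 < a < b < c < 20` whose sorted prefixes keep the step-≤-2 pair-sum chain alive (the only candidates), if the chain of
`{0,a,b,c}` reaches `15` then `17` is NOT a pair sum and `16`, `18` are not BOTH pair sums. [folklore] -/
theorem sectorCheck_two_four :
    ∀ a ∈ List.range 20, (0 < a ∧ (∀ r ∈ List.range (min 16 (a - 1)), (∃ x ∈ [0], ∃ y ∈ [0], x + y = r) ∨ (∃ x ∈ [0], ∃ y ∈ [0], x + y = r + 1))) →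
    ∀ b ∈ List.range 20, (a < b ∧ (∀ r ∈ List.range (min 16 (b - 1)), (∃ x ∈ [0, a], ∃ y ∈ [0, a], x + y = r) ∨ (∃ x ∈ [0, a], ∃ y ∈ [0, a], x + y = r + 1))) →
    ∀ c ∈ List.range 20, (b < c ∧ (∀ r ∈ List.range (min 16 (c - 1)), (∃ x ∈ [0, a, b], ∃ y ∈ [0, a, b], x + y = r) ∨ (∃ x ∈ [0, a, b], ∃ y ∈ [0, a, b], x + y = r + 1))) →
    ((∀ r ∈ List.range 16, (∃ x ∈ [0, a, b, c], ∃ y ∈ [0, a, b, c], x + y = r) ∨ (∃ x ∈ [0, a, b, c], ∃ y ∈ [0, a, b, c], x + y = r + 1)) → (¬ (∃ x ∈ [0, a, b, c], ∃ y ∈ [0, a, b, c], x + y = 17) ∧ ¬ ((∃ x ∈ [0, a, b, c], ∃ y ∈ [0, a, b, c], x + y = 16) ∧ (∃ x ∈ [0, a, b, c], ∃ y ∈ [0, a, b, c], x + y = 18)))) := by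
  decide +kernel

/-- **`η(2,4) ≤ 16 = σ(2,4)`**: every in-sector (`#distinct real roots = natDegree`) determinant of a real symmetric `2 × 2` lacunary pencil with
`4` terms has degree `≤ 16` — `HypRootLawAt 2 4 16`.  (SIEVE `FiniteSector.sieve` + `natDegree_mem_sumset` ⇒ pair-sum chain; values capped at
`19`, value set padded to `4` distinct values and sorted; `sectorCheck_two_four`.) [folklore] -/
theorem hypRootLawAt_two_four_16 : HypRootLawAt 2 4 16 := by
  intro d S hS hsec
  by_contra hdeg'
  have hdeg : 16 < (pencil d S).det.natDegree := not_le.mp hdeg'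
  have hq : (pencil d S).det ≠ 0 := by
    intro h0
    rw [h0] at hdeg
    simp at hdeg
  -- pair sums of exponents
  have hpair : ∀ r, r ∈ (Finset.univ : Finset (Sym (Fin 4) 2)).image
      (fun s : Sym (Fin 4) 2 => ((s : Multiset (Fin 4)).map d).sum) → ∃ i j : Fin 4, d i + d j = r := by
    intro r hr
    rw [Finset.mem_image] at hr
    obtain ⟨s, -, hs⟩ := hr
    have hcard2 : Multiset.card (s : Multiset (Fin 4)) = 2 := s.2
    obtain ⟨i, j, hij⟩ := Multiset.card_eq_two.mp hcard2
    refine ⟨i, j, ?_⟩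
    have hsum : ((s : Multiset (Fin 4)).map d).sum = d i + d j := by
      rw [hij]
      simp
    omega
  have hchain : ∀ r, r + 2 ≤ (pencil d S).det.natDegree →
      (∃ i j : Fin 4, d i + d j = r) ∨ (∃ i j : Fin 4, d i + d j = r + 1) := by
    intro r hr
    rcases sieve d S hq hsec hr with h | h
    · exact Or.inl (hpair _ h)
    · exact Or.inr (hpair _ h)
  have htop : ∃ i j : Fin 4, d i + d j = (pencil d S).det.natDegree := hpair _ (natDegree_mem_sumset d S hq)
  -- capped values, the value set, padding, sorting
  set cv : Fin 4 → ℕ := fun i => min (d i) 19 with hcv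
  have hcvd : ∀ i, d i ≤ 18 → cv i = d i := fun i hi => by
    simp only [hcv]
    exact Nat.min_eq_left (by omega)
  have hcvle : ∀ i, cv i ≤ 19 := fun i => Nat.min_le_right _ _
  set V : Finset ℕ := Finset.univ.image cv with hV
  have hcvV : ∀ i, cv i ∈ V := fun i => Finset.mem_image_of_mem cv (Finset.mem_univ i)
  have h0V : 0 ∈ V := by
    rcases hchain 0 (by omega) with ⟨i, j, hij⟩ | ⟨i, j, hij⟩
    · have : cv i = 0 := by rw [hcvd i (by omega)]; omega
      exact this ▸ hcvV i
    · rcases Nat.eq_zero_or_pos (d i) with hi | hi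
      · have : cv i = 0 := by rw [hcvd i (by omega)]; omega
        exact this ▸ hcvV i
      · have : cv j = 0 := by rw [hcvd j (by omega)]; omega
        exact this ▸ hcvV j
  set W : Finset ℕ := V.erase 0 with hW
  have hWsub : W ⊆ (Finset.range 20).erase 0 := by
    intro u hu
    rw [hW, Finset.mem_erase] at hu
    obtain ⟨hu0, huV⟩ := hu
    rw [hV, Finset.mem_image] at huV
    obtain ⟨i, -, rfl⟩ := huV
    rw [Finset.mem_erase, Finset.mem_range]
    exact ⟨hu0, Nat.lt_succ_of_le (hcvle i)⟩
  have hWcard : W.card ≤ 3 := by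
    have hVK : V.card ≤ 4 := by
      have := Finset.card_image_le (s := (Finset.univ : Finset (Fin 4))) (f := cv)
      simpa using this
    have h1 : W.card + 1 = V.card := by rw [hW]; exact Finset.card_erase_add_one h0V
    omega
  obtain ⟨W', hWW', hW'sub, hW'card⟩ := Finset.exists_subsuperset_card_eq hWsub hWcard
    (by rw [Finset.card_erase_of_mem (by simp), Finset.card_range]; omega)
  have hVW' : ∀ u ∈ V, u = 0 ∨ u ∈ W' := by
    intro u hu
    by_cases hu0 : u = 0
    · exact Or.inl hu0
    · exact Or.inr (hWW' (by rw [hW, Finset.mem_erase]; exact ⟨hu0, hu⟩))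
  have hlmem : ∀ u, u ∈ Finset.sort W' ↔ u ∈ W' := fun u => Finset.mem_sort _
  have hlsort : (Finset.sort W').SortedLT := Finset.sortedLT_sort W'
  have hllen : (Finset.sort W').length = 3 := by rw [Finset.length_sort, hW'card]
  generalize hl : Finset.sort W' = l at hlmem hlsort hllen
  -- name the sorted values
  rcases l with _ | ⟨a, _ | ⟨b, _ | ⟨c, _ | ⟨zz, ll⟩⟩⟩⟩
  all_goals simp only [List.length_cons, List.length_nil] at hllen
  all_goals try omega
  -- bounds and order
  have hmemR : ∀ u, u ∈ [a, b, c] → u ∈ List.range 20 := by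
    intro u hu
    have hu' : u ∈ W' := (hlmem u).mp hu
    have := hW'sub hu'
    rw [Finset.mem_erase, Finset.mem_range] at this
    exact List.mem_range.mpr this.2
  have hne0 : ∀ u, u ∈ [a, b, c] → u ≠ 0 := by
    intro u hu
    have hu' : u ∈ W' := (hlmem u).mp hu
    have := hW'sub hu'
    rw [Finset.mem_erase] at this
    exact this.1
  have h0 : 0 < a := Nat.pos_of_ne_zero (hne0 a (by simp))
  -- membership transfer: a pair sum `r ≤ 18` of `d` is a pair sum of the sorted value list
  have hmemP : ∀ r, r ≤ 18 → (∃ i j : Fin 4, d i + d j = r) → (∃ x ∈ [0, a, b, c], ∃ y ∈ [0, a, b, c], x + y = r) := by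
    rintro r hr ⟨i, j, hij⟩
    have hi : cv i = d i := hcvd i (by omega)
    have hj : cv j = d j := hcvd j (by omega)
    have hin : ∀ u ∈ V, u ∈ [0, a, b, c] := by
      intro u hu
      rcases hVW' u hu with h | h
      · rw [h]; simp
      · exact List.mem_cons_of_mem _ ((hlmem u).mpr h)
    exact ⟨cv i, hin _ (hcvV i), cv j, hin _ (hcvV j), by rw [hi, hj]; exact hij⟩
  have hchainP : ∀ r, r ≤ 15 → (∃ x ∈ [0, a, b, c], ∃ y ∈ [0, a, b, c], x + y = r) ∨ (∃ x ∈ [0, a, b, c], ∃ y ∈ [0, a, b, c], x + y = r + 1) := by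
    intro r hr
    rcases hchain r (by omega) with h | h
    · exact Or.inl (hmemP r (by omega) h)
    · exact Or.inr (hmemP (r + 1) (by omega) h)
  have hfull : (∀ r ∈ List.range 16, (∃ x ∈ [0, a, b, c], ∃ y ∈ [0, a, b, c], x + y = r) ∨ (∃ x ∈ [0, a, b, c], ∃ y ∈ [0, a, b, c], x + y = r + 1)) := fun r hr => hchainP r (by have := List.mem_range.mp hr; omega)
  have hlt1 : a < b := by
    have := hlsort (show (⟨0, by simp⟩ : Fin [a, b, c].length) < ⟨1, by simp⟩ from Fin.mk_lt_mk.mpr (by norm_num))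
    simpa using this
  have hlt2 : b < c := by
    have := hlsort (show (⟨1, by simp⟩ : Fin [a, b, c].length) < ⟨2, by simp⟩ from Fin.mk_lt_mk.mpr (by norm_num))
    simpa using this
  have pre1 : (∀ r ∈ List.range (min 16 (a - 1)), (∃ x ∈ [0], ∃ y ∈ [0], x + y = r) ∨ (∃ x ∈ [0], ∃ y ∈ [0], x + y = r + 1)) := by
    intro r hr
    rw [List.mem_range] at hr
    have hrT : r < 16 := lt_of_lt_of_le hr (min_le_left _ _)
    have hrv : r < a - 1 := lt_of_lt_of_le hr (min_le_right _ _)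
    have hr' : r + 1 < a := by omega
    have hrest : ∀ y ∈ [a, b, c], a ≤ y := by
      intro y hy
      simp only [List.mem_cons, List.mem_nil_iff, or_false] at hy
      omega
    rcases hchainP r (by omega) with h | h
    · exact Or.inl (memP_prefix (l₁ := [0]) (l₂ := [a, b, c]) hrest (by omega) h)
    · exact Or.inr (memP_prefix (l₁ := [0]) (l₂ := [a, b, c]) hrest hr' h)
  have pre2 : (∀ r ∈ List.range (min 16 (b - 1)), (∃ x ∈ [0, a], ∃ y ∈ [0, a], x + y = r) ∨ (∃ x ∈ [0, a], ∃ y ∈ [0, a], x + y = r + 1)) := by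
    intro r hr
    rw [List.mem_range] at hr
    have hrT : r < 16 := lt_of_lt_of_le hr (min_le_left _ _)
    have hrv : r < b - 1 := lt_of_lt_of_le hr (min_le_right _ _)
    have hr' : r + 1 < b := by omega
    have hrest : ∀ y ∈ [b, c], b ≤ y := by
      intro y hy
      simp only [List.mem_cons, List.mem_nil_iff, or_false] at hy
      omega
    rcases hchainP r (by omega) with h | h
    · exact Or.inl (memP_prefix (l₁ := [0, a]) (l₂ := [b, c]) hrest (by omega) h)
    · exact Or.inr (memP_prefix (l₁ := [0, a]) (l₂ := [b, c]) hrest hr' h)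
  have pre3 : (∀ r ∈ List.range (min 16 (c - 1)), (∃ x ∈ [0, a, b], ∃ y ∈ [0, a, b], x + y = r) ∨ (∃ x ∈ [0, a, b], ∃ y ∈ [0, a, b], x + y = r + 1)) := by
    intro r hr
    rw [List.mem_range] at hr
    have hrT : r < 16 := lt_of_lt_of_le hr (min_le_left _ _)
    have hrv : r < c - 1 := lt_of_lt_of_le hr (min_le_right _ _)
    have hr' : r + 1 < c := by omega
    have hrest : ∀ y ∈ [c], c ≤ y := by
      intro y hy
      simp only [List.mem_cons, List.mem_nil_iff, or_false] at hy
      omega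
    rcases hchainP r (by omega) with h | h
    · exact Or.inl (memP_prefix (l₁ := [0, a, b]) (l₂ := [c]) hrest (by omega) h)
    · exact Or.inr (memP_prefix (l₁ := [0, a, b]) (l₂ := [c]) hrest hr' h)
  -- apply the kernel check
  obtain ⟨hno17, hno1618⟩ := sectorCheck_two_four a (hmemR a (by simp)) ⟨h0, pre1⟩ b (hmemR b (by simp)) ⟨hlt1, pre2⟩ c (hmemR c (by simp)) ⟨hlt2, pre3⟩ hfull
  -- degree 17, 18, or ≥ 19: each contradicts the check
  rcases Nat.lt_or_ge (pencil d S).det.natDegree 19 with hsmall | hbig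
  · interval_cases h : (pencil d S).det.natDegree
    · exact hno17 (hmemP 17 (by omega) (h ▸ htop))
    · have h18 : (∃ x ∈ [0, a, b, c], ∃ y ∈ [0, a, b, c], x + y = 18) :=
        hmemP 18 (by omega) (h ▸ htop)
      rcases hchain 16 (by omega) with h' | h'
      · exact hno1618 ⟨hmemP 16 (by omega) h', h18⟩
      · exact hno17 (hmemP 17 (by omega) h')
  · rcases hchain 16 (by omega) with h1 | h1
    · rcases hchain 17 (by omega) with h2 | h2
      · exact hno17 (hmemP 17 (by omega) h2)
      · exact hno1618 ⟨hmemP 16 (by omega) h1, hmemP 18 (by omega) h2⟩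
    · exact hno17 (hmemP 17 (by omega) h1)

end Summit.ValiantsHypothesis.ValiantsHypothesis.Theorems.LacunarySymmetroidMatrixDescartes.FiniteSector
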